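import Literature.Topology.FourManifolds.TrisectionsTubeSaturationModel
import Literature.Topology.FourManifolds.TrisectionsSectorWeight
import Literature.Topology.FourManifolds.TrisectionsRadialThickening
import HarnessLib

/-!
# The middle sector's function on a handle column: critical points and the centre (model computation)

Topic `Literature/Topology/FourManifolds`; model-space calculus for the fact seat
`provefact-Literature.Topology.FourManifolds.exists_isBalancedGKTrisection` (Gay–Kirby 2016,
Thm. 4 via §4, Lemma 14).  Everything in this file is **proved**; the definitions are explicit
functions on `ℝ³` and `ℝ⁴`.

In Milnor's coordinates `u = (x⃗, y⃗)` of a `2`-handle (`A = |x⃗|²`, `B = |y⃗|²`, height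
`s = η - A + B`, top height `T₀`), on the column of the handle below the lid `{s = T₀}` the
function `Ψ₂` of the middle sector `X₂` of the trisection
(`TrisectionsMidSectorFunction.lean`: `Ψ₂ = (-V)(-M̃) W R` with `-V = s`, `-M̃ = T₀ - s` on the
plateau, `W = w(c₀ 𝒯̂)`, `R = R(A)`) reads

  `G(u) = s · (T₀ - s) · w(c₀ 𝒯̂(u)) · R(A)`,  `𝒯̂ = ĝ(x⃗) + (κ/η) A B`, `ĝ = 1 - ε x₀² ρ(A)`

(`TubeColumn.colFn`, the radial thickening `Φ(x⃗, |y⃗|²)` of `TubeColumn.colFn3`).  This file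
proves:

* `TubeColumn.bsq_eq_zero_of_fderiv_colFn_eq_zero` — **a critical point of `G` lies on the
  core disc `y⃗ = 0`**, by testing `dG` against the radial fields in `x⃗`, `y⃗` (as in
  `TrisectionsTubeSaturationModel.lean`): off the disc the `y⃗`-radial equation gives
  `(T₀ - 2s) w = s(T₀ - s)|w'| c₀ (κ/η) A`, and then the `x⃗`-radial derivative is
  `s(T₀ - s)R · [2(κ/η)AB w' c₀ + …] < 0` under the pointwise **radial inequality**
  `ε x₀² (ρ + Aρ')|w'| c₀ R ≤ A w |R'| + A² (κ/η)|w'| c₀ R` (`w' < 0`, `R' ≤ 0`; trivially true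
  where `ρ(A) = 1/A`);
* `TubeColumn.colFn_comp_lift₄` — on the core disc `G` is the chart-zone core
  `𝒜(|x⃗|²) w(c₀ ĝ(x⃗))` of `TrisectionsChartZoneCore.lean` with `𝒜(a) = (η - a)(T₀ - η + a)R(a)`,
  so that (`TubeColumn.eq_zero_of_fderiv_colFn_eq_zero`) under the design inequality the only
  critical point of `G` on the column is the centre `u = 0` (the critical point of `f`);
* `TubeColumn.morseData_one_sub_colFn_zero` — **`1 - C G` has a nondegenerate critical point of
  index `0` at the centre** (`T₀ < 2η`: `∂G/∂B(0) = (T₀ - 2η) w(c₀) R(0) < 0`, and the core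
  Hessian is negative definite, `ChartZone.fderiv_fderiv_core_zero_apply_self_neg`).

This is the column half (Gay–Kirby: "the `2`-handles cancel `g - k` of the `S¹ × B³`'s",
proof of Lemma 14) of the Morse analysis of `X₂`.

## References

* D. Gay, R. Kirby, *Trisecting 4-manifolds*, Geom. Topol. 20 (2016), §4, Lemma 14. [GayKirby2016]
* J. Milnor, *Lectures on the h-cobordism theorem* (1965), Def. 3.1, proof of Thm. 3.12. [MilnorHCobordism1965]
* J. Milnor, *Morse theory* (1963), §2. [Milnor1963]
-/

open scoped Topology Manifold ContDiff
open Set Function Filter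

noncomputable section

namespace Literature.Topology.FourManifolds

/-- Local notation: `𝔼 n` is the model Euclidean space `EuclideanSpace ℝ (Fin n)`. -/
local notation "𝔼 " n:arg => EuclideanSpace ℝ (Fin n)

namespace TubeColumn

open TubeModel RadialThickening TubeSaturation ChartZone
open PlanarThickening (lift ez)

variable {w ρ R : ℝ → ℝ} {c₀ ε κ η T₀ : ℝ}

/-! ### The column function -/

/-- **The column function on `ℝ³`** (`x⃗ ∈ ℝ²`, `b` the squared co-core radius):
`Φ(x⃗, b) = s (T₀ - s) w(c₀(ĝ(x⃗) + (κ/η)|x⃗|² b)) R(|x⃗|²)`, `s = η - |x⃗|² + b`. [cite: GayKirby2016, §4, Lemma 14] -/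
def colFn3 (w ρ R : ℝ → ℝ) (c₀ ε κ η T₀ : ℝ) (q : 𝔼 3) : ℝ :=
  (η - nsq (PlanarThickening.proj q) + q 2) * (T₀ - (η - nsq (PlanarThickening.proj q) + q 2)) *
    w (c₀ * (gmod ε ρ (PlanarThickening.proj q) + κ / η * nsq (PlanarThickening.proj q) * q 2)) *
    R (nsq (PlanarThickening.proj q))

/-- **The column function on the handle**: the radial thickening `G(x⃗, y⃗) = Φ(x⃗, |y⃗|²)`. [cite: GayKirby2016, §4, Lemma 14] -/
def colFn (w ρ R : ℝ → ℝ) (c₀ ε κ η T₀ : ℝ) : 𝔼 4 → ℝ := rthicken (colFn3 w ρ R c₀ ε κ η T₀)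

/-- **`G = s (T₀ - s) w(c₀ 𝒯̂) R(A)`.** [cite: GayKirby2016, §4, Lemma 14] -/
theorem colFn_apply (u : 𝔼 4) :
    colFn w ρ R c₀ ε κ η T₀ u = sM η u * (T₀ - sM η u) * w (c₀ * tubeHat ε κ η ρ u) * R (nsq (proj u)) := by
  rw [colFn, rthicken_apply, colFn3, TubeModel.planarProj_toModel, toModel_apply_two, sM_apply, tubeHat_apply]

/-- `G` as a function. [folklore] -/
theorem colFn_eq : colFn w ρ R c₀ ε κ η T₀ =
    fun u => sM η u * (T₀ - sM η u) * w (c₀ * tubeHat ε κ η ρ u) * R (nsq (proj u)) :=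
  funext colFn_apply

/-- **On the core disc the column function is the chart-zone core** with
`𝒜(a) = (η - a)(T₀ - η + a) R(a)`. [folklore] -/
theorem colFn_comp_lift₄ :
    colFn w ρ R c₀ ε κ η T₀ ∘ (lift₄ : 𝔼 2 →L[ℝ] 𝔼 4) = core (fun a => (η - a) * (T₀ - η + a) * R a) w ρ c₀ ε := by
  funext x
  simp only [comp_apply, colFn_apply, core_apply, sM_apply, tubeHat_apply, proj_lift₄, bsq_lift₄]
  ring_nf

/-- The same for the function on `ℝ³` and the planar lift. [folklore] -/
theorem colFn3_comp_lift :
    colFn3 w ρ R c₀ ε κ η T₀ ∘ (lift : 𝔼 2 →L[ℝ] 𝔼 3) = core (fun a => (η - a) * (T₀ - η + a) * R a) w ρ c₀ ε := by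
  funext x
  simp only [comp_apply, colFn3, core_apply, PlanarThickening.proj_lift, PlanarThickening.lift_apply_two,
    add_zero, mul_zero]
  ring_nf

/-! ### The derivative of the smoothed tube function -/

/-- **`D𝒯̂_u(v)`** for `ρ` differentiable at `A`:
`-ε[2x₀v₀ ρ(A) + x₀² ρ'(A)(2x₀v₀ + 2x₁v₁)] + (κ/η)[B(2x₀v₀ + 2x₁v₁) + A(2y₀v₂ + 2y₁v₃)]`. [folklore] -/
theorem hasFDerivAt_tubeHat {u : 𝔼 4} (hρ : DifferentiableAt ℝ ρ (nsq (proj u))) :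
    HasFDerivAt (tubeHat ε κ η ρ)
      ((-(ε • ((ρ (nsq (proj u)) * (2 * u 0)) • (d0 : 𝔼 2 →L[ℝ] ℝ) +
        (u 0 ^ 2 * deriv ρ (nsq (proj u))) • ((2 * u 0) • (d0 : 𝔼 2 →L[ℝ] ℝ) + (2 * u 1) • (d1 : 𝔼 2 →L[ℝ] ℝ))))).comp proj +
        (κ / η) • (nsq (proj u) • ((2 * u 2) • (c2 : 𝔼 4 →L[ℝ] ℝ) + (2 * u 3) • (c3 : 𝔼 4 →L[ℝ] ℝ)) +
          bsq u • (((2 * u 0) • (d0 : 𝔼 2 →L[ℝ] ℝ) + (2 * u 1) • (d1 : 𝔼 2 →L[ℝ] ℝ)).comp proj))) u := by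
  have h1 : HasFDerivAt (fun u : 𝔼 4 => gmod ε ρ (proj u)) _ u :=
    (hasFDerivAt_gmod (ε := ε) (x := proj u) (by simpa using hρ)).comp u proj.hasFDerivAt
  have h2 := ((hasFDerivAt_nsq_proj u).mul (hasFDerivAt_bsq u)).const_smul (κ / η)
  have h := h1.add h2
  have hfun : tubeHat ε κ η ρ = fun u => gmod ε ρ (proj u) + (κ / η) • (nsq (proj u) * bsq u) := by
    funext u; rw [tubeHat_apply, smul_eq_mul]; ring
  rw [hfun]
  refine h.congr_fderiv ?_
  simp only [proj_apply_zero, proj_apply_one]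

/-- `𝒯̂` is differentiable where `ρ` is. [folklore] -/
theorem differentiableAt_tubeHat {u : 𝔼 4} (hρ : DifferentiableAt ℝ ρ (nsq (proj u))) :
    DifferentiableAt ℝ (tubeHat ε κ η ρ) u :=
  (hasFDerivAt_tubeHat hρ).differentiableAt

/-- **`D𝒯̂(v)` in coordinates.** [folklore] -/
theorem fderiv_tubeHat_apply {u : 𝔼 4} (hρ : DifferentiableAt ℝ ρ (nsq (proj u))) (v : 𝔼 4) :
    fderiv ℝ (tubeHat ε κ η ρ) u v =
      -(ε * (ρ (nsq (proj u)) * (2 * u 0) * v 0 +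
          u 0 ^ 2 * deriv ρ (nsq (proj u)) * (2 * u 0 * v 0 + 2 * u 1 * v 1))) +
        κ / η * (nsq (proj u) * (2 * u 2 * v 2 + 2 * u 3 * v 3) + bsq u * (2 * u 0 * v 0 + 2 * u 1 * v 1)) := by
  rw [(hasFDerivAt_tubeHat hρ).fderiv]
  simp only [add_apply, ContinuousLinearMap.comp_apply, neg_apply, smul_apply, d0_apply, d1_apply,
    c2_apply, c3_apply, proj_apply_zero, proj_apply_one, smul_eq_mul]

/-- `D𝒯̂(radialX) = -2ε x₀²(ρ + Aρ') + (κ/η) 2AB`. [folklore] -/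
theorem fderiv_tubeHat_radialX {u : 𝔼 4} (hρ : DifferentiableAt ℝ ρ (nsq (proj u))) :
    fderiv ℝ (tubeHat ε κ η ρ) u (radialX u) =
      -(2 * ε * u 0 ^ 2 * (ρ (nsq (proj u)) + nsq (proj u) * deriv ρ (nsq (proj u)))) +
        κ / η * (2 * nsq (proj u) * bsq u) := by
  rw [fderiv_tubeHat_apply hρ, nsq_proj]
  simp only [radialX_apply_zero, radialX_apply_one, radialX_apply_two, radialX_apply_three]
  ring

/-- `D𝒯̂(radialY) = (κ/η) 2AB`. [folklore] -/
theorem fderiv_tubeHat_radialY {u : 𝔼 4} (hρ : DifferentiableAt ℝ ρ (nsq (proj u))) :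
    fderiv ℝ (tubeHat ε κ η ρ) u (radialY u) = κ / η * (2 * nsq (proj u) * bsq u) := by
  rw [fderiv_tubeHat_apply hρ, bsq_apply]
  simp only [radialY_apply_zero, radialY_apply_one, radialY_apply_two, radialY_apply_three]
  ring

/-- `D𝒯̂(rotX) = 2ε x₀x₁ ρ(A)`. [folklore] -/
theorem fderiv_tubeHat_rotX {u : 𝔼 4} (hρ : DifferentiableAt ℝ ρ (nsq (proj u))) :
    fderiv ℝ (tubeHat ε κ η ρ) u (rotX u) = 2 * ε * u 0 * u 1 * ρ (nsq (proj u)) := by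
  rw [fderiv_tubeHat_apply hρ]
  simp only [rotX_apply_zero, rotX_apply_one, rotX_apply_two, rotX_apply_three]
  ring

/-! ### The directional derivatives of `G` -/

/-- **The derivative of `G` along a vector** (product and chain rules), `s = s(u)`,
`t = c₀ 𝒯̂(u)`, `A = |x⃗|²`:
`dG(v) = (T₀ - 2s) ds(v) w(t) R(A) + s(T₀ - s) w'(t) c₀ d𝒯̂(v) R(A) + s(T₀ - s) w(t) R'(A) dA(v)`. [folklore] -/
theorem fderiv_colFn_apply {u : 𝔼 4} (hw : DifferentiableAt ℝ w (c₀ * tubeHat ε κ η ρ u))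
    (hρ : DifferentiableAt ℝ ρ (nsq (proj u))) (hR : DifferentiableAt ℝ R (nsq (proj u))) (v : 𝔼 4) :
    fderiv ℝ (colFn w ρ R c₀ ε κ η T₀) u v =
      (T₀ - 2 * sM η u) * fderiv ℝ (sM η) u v * w (c₀ * tubeHat ε κ η ρ u) * R (nsq (proj u)) +
        sM η u * (T₀ - sM η u) * (deriv w (c₀ * tubeHat ε κ η ρ u) * (c₀ * fderiv ℝ (tubeHat ε κ η ρ) u v)) *
          R (nsq (proj u)) +
        sM η u * (T₀ - sM η u) * w (c₀ * tubeHat ε κ η ρ u) *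
          (deriv R (nsq (proj u)) * fderiv ℝ (fun u : 𝔼 4 => nsq (proj u)) u v) := by
  have hs := differentiableAt_sM η u
  have hT : DifferentiableAt ℝ (tubeHat ε κ η ρ) u := differentiableAt_tubeHat hρ
  have hV : HasFDerivAt (fun u => T₀ - sM η u) (-fderiv ℝ (sM η) u) u := hs.hasFDerivAt.const_sub T₀
  have hW : HasFDerivAt (fun u => w (c₀ * tubeHat ε κ η ρ u))
      (deriv w (c₀ * tubeHat ε κ η ρ u) • (c₀ • fderiv ℝ (tubeHat ε κ η ρ) u)) u :=
    hw.hasDerivAt.comp_hasFDerivAt u (hT.hasFDerivAt.const_smul c₀)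
  have hRR : HasFDerivAt (fun u : 𝔼 4 => R (nsq (proj u)))
      (deriv R (nsq (proj u)) • fderiv ℝ (fun u : 𝔼 4 => nsq (proj u)) u) u :=
    hR.hasDerivAt.comp_hasFDerivAt u (differentiableAt_nsq_proj u).hasFDerivAt
  have hG : HasFDerivAt (fun u => sM η u * (T₀ - sM η u) * w (c₀ * tubeHat ε κ η ρ u) * R (nsq (proj u))) _ u :=
    ((hs.hasFDerivAt.mul hV).mul hW).mul hRR
  rw [colFn_eq, hG.fderiv]
  simp only [add_apply, smul_apply, smul_eq_mul, neg_apply, Pi.mul_apply]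
  ring

/-- **`dG` along the rotation field in `x⃗`**: `s (T₀ - s) w' c₀ · 2ε x₀x₁ ρ(A) · R`. [cite: GayKirby2016, §4, Lemma 14] -/
theorem fderiv_colFn_rotX {u : 𝔼 4} (hw : DifferentiableAt ℝ w (c₀ * tubeHat ε κ η ρ u))
    (hρ : DifferentiableAt ℝ ρ (nsq (proj u))) (hR : DifferentiableAt ℝ R (nsq (proj u))) :
    fderiv ℝ (colFn w ρ R c₀ ε κ η T₀) u (rotX u) =
      sM η u * (T₀ - sM η u) * deriv w (c₀ * tubeHat ε κ η ρ u) * c₀ *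
        (2 * ε * u 0 * u 1 * ρ (nsq (proj u))) * R (nsq (proj u)) := by
  rw [fderiv_colFn_apply hw hρ hR, fderiv_sM_rotX, fderiv_tubeHat_rotX hρ, fderiv_nsq_proj_apply]
  simp only [rotX_apply_zero, rotX_apply_one]
  ring

/-- **`dG` along the radial field in `y⃗`**: `2B R [(T₀ - 2s) w + s (T₀ - s) w' c₀ (κ/η) A]`. [cite: GayKirby2016, §4, Lemma 14] -/
theorem fderiv_colFn_radialY {u : 𝔼 4} (hw : DifferentiableAt ℝ w (c₀ * tubeHat ε κ η ρ u))
    (hρ : DifferentiableAt ℝ ρ (nsq (proj u))) (hR : DifferentiableAt ℝ R (nsq (proj u))) :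
    fderiv ℝ (colFn w ρ R c₀ ε κ η T₀) u (radialY u) =
      2 * bsq u * R (nsq (proj u)) *
        ((T₀ - 2 * sM η u) * w (c₀ * tubeHat ε κ η ρ u) +
          sM η u * (T₀ - sM η u) * deriv w (c₀ * tubeHat ε κ η ρ u) * c₀ * (κ / η) * nsq (proj u)) := by
  rw [fderiv_colFn_apply hw hρ hR, fderiv_sM_radialY, fderiv_tubeHat_radialY hρ, fderiv_nsq_proj_apply]
  simp only [radialY_apply_zero, radialY_apply_one]
  ring

/-- **`dG` along the radial field in `x⃗`**:
`(T₀ - 2s)(-2A) w R + s(T₀ - s) w' c₀ [-2ε x₀²(ρ + Aρ') + 2(κ/η)AB] R + s(T₀ - s) w R' 2A`. [cite: GayKirby2016, §4, Lemma 14] -/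
theorem fderiv_colFn_radialX {u : 𝔼 4} (hw : DifferentiableAt ℝ w (c₀ * tubeHat ε κ η ρ u))
    (hρ : DifferentiableAt ℝ ρ (nsq (proj u))) (hR : DifferentiableAt ℝ R (nsq (proj u))) :
    fderiv ℝ (colFn w ρ R c₀ ε κ η T₀) u (radialX u) =
      (T₀ - 2 * sM η u) * (-(2 * nsq (proj u))) * w (c₀ * tubeHat ε κ η ρ u) * R (nsq (proj u)) +
        sM η u * (T₀ - sM η u) * deriv w (c₀ * tubeHat ε κ η ρ u) * c₀ *
          (-(2 * ε * u 0 ^ 2 * (ρ (nsq (proj u)) + nsq (proj u) * deriv ρ (nsq (proj u)))) +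
            κ / η * (2 * nsq (proj u) * bsq u)) * R (nsq (proj u)) +
        sM η u * (T₀ - sM η u) * w (c₀ * tubeHat ε κ η ρ u) * deriv R (nsq (proj u)) * (2 * nsq (proj u)) := by
  rw [fderiv_colFn_apply hw hρ hR, fderiv_sM_radialX, fderiv_tubeHat_radialX hρ, fderiv_nsq_proj_apply, nsq_proj]
  simp only [radialX_apply_zero, radialX_apply_one]
  ring

/-! ### The critical points of `G` lie on the core disc -/

/-- **A critical point of the column function lies on the core disc `y⃗ = 0`.**  Hypotheses at
`u`: `0 < s < T₀` (an interior point of the column), `T₀ < 2η` (the lid is low),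
`w > 0 > w'` at `t = c₀ 𝒯̂(u)`, `R > 0` at `A`, `c₀ > 0`, `κ/η > 0`, and the
**radial inequality** `ε x₀² (ρ(A) + A ρ'(A)) |w'| c₀ R ≤ A w |R'| + A² (κ/η) |w'| c₀ R`.  Then
`dG(u) = 0` forces `B = |y⃗|² = 0`: if `x⃗ = 0` the `y⃗`-radial derivative is
`2B R (T₀ - 2s) w` with `s = η + B > T₀/2`; if `x⃗ ≠ 0` and `B ≠ 0`, the `y⃗`-radial equation
gives `(T₀ - 2s) w = s (T₀ - s)|w'| c₀ (κ/η) A`, and substituting it the `x⃗`-radial derivative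
becomes `s(T₀ - s)R · {…}` with `{…} ≤ 2(κ/η) A B w' c₀ < 0`. [cite: GayKirby2016, §4, Lemma 14] -/
theorem bsq_eq_zero_of_fderiv_colFn_eq_zero {u : 𝔼 4} (hw : DifferentiableAt ℝ w (c₀ * tubeHat ε κ η ρ u))
    (hρ : DifferentiableAt ℝ ρ (nsq (proj u))) (hR : DifferentiableAt ℝ R (nsq (proj u)))
    (hs : 0 < sM η u) (hs' : 0 < T₀ - sM η u) (hT : T₀ < 2 * η)
    (hW : 0 < w (c₀ * tubeHat ε κ η ρ u)) (hW' : deriv w (c₀ * tubeHat ε κ η ρ u) < 0)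
    (hRpos : 0 < R (nsq (proj u))) (hc₀ : 0 < c₀) (hκ : 0 < κ / η)
    (hrad : ε * u 0 ^ 2 * (ρ (nsq (proj u)) + nsq (proj u) * deriv ρ (nsq (proj u))) *
        (-deriv w (c₀ * tubeHat ε κ η ρ u)) * c₀ * R (nsq (proj u)) ≤
      nsq (proj u) * w (c₀ * tubeHat ε κ η ρ u) * (-deriv R (nsq (proj u))) +
        nsq (proj u) ^ 2 * (κ / η) * (-deriv w (c₀ * tubeHat ε κ η ρ u)) * c₀ * R (nsq (proj u)))
    (h0 : fderiv ℝ (colFn w ρ R c₀ ε κ η T₀) u = 0) : bsq u = 0 := by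
  set s := sM η u with hsdef
  set W := w (c₀ * tubeHat ε κ η ρ u)
  set W' := deriv w (c₀ * tubeHat ε κ η ρ u)
  set A := nsq (proj u) with hAdef
  set Bv := bsq u with hBdef
  set Rv := R (nsq (proj u))
  set R' := deriv R (nsq (proj u)) with hR'def
  have hA0 : 0 ≤ A := by rw [hAdef, nsq_apply]; positivity
  have hB0 : 0 ≤ Bv := bsq_nonneg u
  have hY := fderiv_colFn_radialY (c₀ := c₀) (ε := ε) (κ := κ) (η := η) (T₀ := T₀) hw hρ hR
  have hX := fderiv_colFn_radialX (c₀ := c₀) (ε := ε) (κ := κ) (η := η) (T₀ := T₀) hw hρ hR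
  rw [h0, zero_apply] at hX hY
  by_contra hBne
  have hBpos : 0 < Bv := lt_of_le_of_ne hB0 (Ne.symm hBne)
  -- the `y⃗`-radial equation
  have hβ : (T₀ - 2 * s) * W + s * (T₀ - s) * W' * c₀ * (κ / η) * A = 0 := by
    have h2 : 2 * Bv * Rv ≠ 0 := by positivity
    rcases mul_eq_zero.1 hY.symm with h | h
    · exact absurd h h2
    · exact h
  rcases hA0.eq_or_lt with hAz | hApos
  · -- `x⃗ = 0`: `s = η + B > T₀ / 2`
    have hsval : s = η - A + Bv := rfl
    rw [← hAz] at hβ hsval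
    have h1 : (T₀ - 2 * s) * W = 0 := by simpa using hβ
    rcases mul_eq_zero.1 h1 with h | h
    · linarith
    · exact absurd h hW.ne'
  · -- `x⃗ ≠ 0`, `B ≠ 0`: the `x⃗`-radial derivative is negative
    have hx0 : u 0 ^ 2 ≤ A := by rw [hAdef, nsq_apply, proj_apply_zero, proj_apply_one]; nlinarith [sq_nonneg (u 1)]
    -- rewrite the `x⃗`-radial derivative using `hβ`
    set E := ρ A + A * deriv ρ A with hE
    have hsub : (T₀ - 2 * s) * W = -(s * (T₀ - s) * W' * c₀ * (κ / η) * A) := by linarith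
    have hkey : (T₀ - 2 * s) * (-(2 * A)) * W * Rv +
        s * (T₀ - s) * W' * c₀ * (-(2 * ε * u 0 ^ 2 * E) + κ / η * (2 * A * Bv)) * Rv +
        s * (T₀ - s) * W * R' * (2 * A) =
        s * (T₀ - s) * (2 * A * W' * c₀ * (κ / η) * A * Rv - 2 * ε * u 0 ^ 2 * E * W' * c₀ * Rv +
          2 * (κ / η) * A * Bv * W' * c₀ * Rv + 2 * A * W * R') := by
      rw [show (T₀ - 2 * s) * (-(2 * A)) * W * Rv = ((T₀ - 2 * s) * W) * (-(2 * A)) * Rv by ring, hsub]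
      ring
    have hX' : (0 : ℝ) = s * (T₀ - s) * (2 * A * W' * c₀ * (κ / η) * A * Rv - 2 * ε * u 0 ^ 2 * E * W' * c₀ * Rv +
          2 * (κ / η) * A * Bv * W' * c₀ * Rv + 2 * A * W * R') := by
      rw [← hkey]; exact hX
    have hP : 0 < s * (T₀ - s) := mul_pos hs hs'
    -- the four terms of the bracket
    have t1 : 2 * A * W' * c₀ * (κ / η) * A * Rv ≤ 0 := by
      have : 0 ≤ 2 * A * c₀ * (κ / η) * A * Rv := by positivity
      nlinarith
    have t3 : 2 * (κ / η) * A * Bv * W' * c₀ * Rv < 0 := by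
      have : 0 < 2 * (κ / η) * A * Bv * c₀ * Rv := by positivity
      nlinarith
    have t2 : -(2 * ε * u 0 ^ 2 * E * W' * c₀ * Rv) ≤
        -(2 * A * W' * c₀ * (κ / η) * A * Rv) + -(2 * A * W * R') := by
      have h2 : ε * u 0 ^ 2 * E * -W' * c₀ * Rv ≤ A * W * -R' + A ^ 2 * (κ / η) * -W' * c₀ * Rv := hrad
      linarith
    have hbr : 2 * A * W' * c₀ * (κ / η) * A * Rv - 2 * ε * u 0 ^ 2 * E * W' * c₀ * Rv +
        2 * (κ / η) * A * Bv * W' * c₀ * Rv + 2 * A * W * R' < 0 := by linarith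
    have hneg : s * (T₀ - s) * (2 * A * W' * c₀ * (κ / η) * A * Rv - 2 * ε * u 0 ^ 2 * E * W' * c₀ * Rv +
        2 * (κ / η) * A * Bv * W' * c₀ * Rv + 2 * A * W * R') < 0 := mul_neg_of_pos_of_neg hP hbr
    linarith

/-- **On the core disc the derivative of `G` restricts to the derivative of the core.** [folklore] -/
theorem fderiv_core_eq_comp_lift₄ {x : 𝔼 2} (hG : DifferentiableAt ℝ (colFn w ρ R c₀ ε κ η T₀) (lift₄ x)) :
    fderiv ℝ (core (fun a => (η - a) * (T₀ - η + a) * R a) w ρ c₀ ε) x =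
      (fderiv ℝ (colFn w ρ R c₀ ε κ η T₀) (lift₄ x)).comp (lift₄ : 𝔼 2 →L[ℝ] 𝔼 4) := by
  rw [← colFn_comp_lift₄, fderiv_comp x hG (lift₄ : 𝔼 2 →L[ℝ] 𝔼 4).differentiableAt, ContinuousLinearMap.fderiv]

/-- **The only critical point of the column function on the column is the centre.**  At a point
`u` with the hypotheses of `bsq_eq_zero_of_fderiv_colFn_eq_zero`, and at `x⃗ = π u` the
hypotheses of `ChartZone.eq_zero_of_fderiv_core_eq_zero` for `𝒜(a) = (η - a)(T₀ - η + a)R(a)`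
(`𝒜 > 0`, `ρ ≥ 0 ≥ ρ'`, `w' ≤ 0` at `c₀ ĝ(x⃗)`, `ε ≥ 0`, the design inequality), `dG(u) = 0` forces `u = 0`. [cite: GayKirby2016, §4, Lemma 14] -/
theorem eq_zero_of_fderiv_colFn_eq_zero {u : 𝔼 4} (hw : Differentiable ℝ w) (hρd : Differentiable ℝ ρ)
    (hRd : Differentiable ℝ R)
    (hs : 0 < sM η u) (hs' : 0 < T₀ - sM η u) (hT : T₀ < 2 * η)
    (hW : 0 < w (c₀ * tubeHat ε κ η ρ u)) (hW' : deriv w (c₀ * tubeHat ε κ η ρ u) < 0)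
    (hRpos : 0 < R (nsq (proj u))) (hc₀ : 0 < c₀) (hκ : 0 < κ / η) (hε : 0 ≤ ε)
    (hrad : ε * u 0 ^ 2 * (ρ (nsq (proj u)) + nsq (proj u) * deriv ρ (nsq (proj u))) *
        (-deriv w (c₀ * tubeHat ε κ η ρ u)) * c₀ * R (nsq (proj u)) ≤
      nsq (proj u) * w (c₀ * tubeHat ε κ η ρ u) * (-deriv R (nsq (proj u))) +
        nsq (proj u) ^ 2 * (κ / η) * (-deriv w (c₀ * tubeHat ε κ η ρ u)) * c₀ * R (nsq (proj u)))
    (hApos : 0 < (η - nsq (proj u)) * (T₀ - η + nsq (proj u)) * R (nsq (proj u)))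
    (hρ0 : 0 ≤ ρ (nsq (proj u))) (hρ' : deriv ρ (nsq (proj u)) ≤ 0)
    (hw'c : deriv w (c₀ * gmod ε ρ (proj u)) ≤ 0)
    (hD : DesignIneq (fun a => (η - a) * (T₀ - η + a) * R a) w ρ c₀ ε (nsq (proj u)) (c₀ * gmod ε ρ (proj u)))
    (h0 : fderiv ℝ (colFn w ρ R c₀ ε κ η T₀) u = 0) : u = 0 := by
  have hB := bsq_eq_zero_of_fderiv_colFn_eq_zero (hw _) (hρd _) (hRd _) hs hs' hT hW hW' hRpos hc₀ hκ hrad h0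
  obtain ⟨h2, h3⟩ := (bsq_eq_zero_iff u).1 hB
  have hu : u = lift₄ (proj u) := (eq_lift₄_proj_iff u).2 ⟨h2, h3⟩
  have hG : DifferentiableAt ℝ (colFn w ρ R c₀ ε κ η T₀) (lift₄ (proj u)) := by
    rw [← hu, colFn_eq]
    exact (((differentiableAt_sM η u).mul ((differentiableAt_const _).sub (differentiableAt_sM η u))).mul
      ((hw _).comp u ((differentiableAt_tubeHat (hρd _)).const_mul c₀))).mul ((hRd _).comp u (differentiableAt_nsq_proj u))
  have hcore : fderiv ℝ (core (fun a => (η - a) * (T₀ - η + a) * R a) w ρ c₀ ε) (proj u) = 0 := by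
    rw [fderiv_core_eq_comp_lift₄ hG, ← hu, h0, ContinuousLinearMap.zero_comp]
  have hAd : DifferentiableAt ℝ (fun a => (η - a) * (T₀ - η + a) * R a) (nsq (proj u)) :=
    ((((differentiableAt_const _).sub differentiableAt_id)).mul ((differentiableAt_const _).add differentiableAt_id)).mul (hRd _)
  have hx : proj u = 0 :=
    eq_zero_of_fderiv_core_eq_zero hAd (hw _) (hρd _) hApos hρ0 hρ' hw'c (mul_nonneg hc₀.le hε) hD hcore
  rw [hu, hx, map_zero]

/-! ### The centre: a nondegenerate minimum of `1 - C G` -/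

/-- `π₃ 0 = 0`. [folklore] -/
@[simp] theorem planarProj_zero : PlanarThickening.proj (0 : 𝔼 3) = 0 := map_zero _

/-- The column function on `ℝ³` is `C²` for `C²` profiles. [folklore] -/
theorem contDiff_colFn3 (hw : ContDiff ℝ 2 w) (hρ : ContDiff ℝ 2 ρ) (hR : ContDiff ℝ 2 R) :
    ContDiff ℝ 2 (colFn3 w ρ R c₀ ε κ η T₀) := by
  have hp : ContDiff ℝ 2 (PlanarThickening.proj : 𝔼 3 → 𝔼 2) := PlanarThickening.proj.contDiff
  have hn : ContDiff ℝ 2 fun q : 𝔼 3 => nsq (PlanarThickening.proj q) := contDiff_nsq.comp hp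
  have h2 : ContDiff ℝ 2 fun q : 𝔼 3 => q 2 := (PlanarThickening.zc : 𝔼 3 →L[ℝ] ℝ).contDiff
  have h0 : ContDiff ℝ 2 fun q : 𝔼 3 => (PlanarThickening.proj q) 0 :=
    (d0 : 𝔼 2 →L[ℝ] ℝ).contDiff.comp hp
  have hg : ContDiff ℝ 2 fun q : 𝔼 3 => gmod ε ρ (PlanarThickening.proj q) := by
    unfold gmod
    exact contDiff_const.sub (contDiff_const.mul ((h0.pow 2).mul (hρ.comp hn)))
  have hs : ContDiff ℝ 2 fun q : 𝔼 3 => η - nsq (PlanarThickening.proj q) + q 2 := (contDiff_const.sub hn).add h2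
  unfold colFn3
  exact ((hs.mul (contDiff_const.sub hs)).mul
    (hw.comp (contDiff_const.mul (hg.add ((contDiff_const.mul hn).mul h2))))).mul (hR.comp hn)

/-- **`∂Φ/∂b` at the centre**: `fderiv colFn3 0 ez = (T₀ - 2η) w(c₀) R(0)`. [folklore] -/
theorem fderiv_colFn3_zero_ez (hw : ContDiff ℝ 2 w) (hρ : ContDiff ℝ 2 ρ) (hR : ContDiff ℝ 2 R) :
    fderiv ℝ (colFn3 w ρ R c₀ ε κ η T₀) 0 ez = (T₀ - 2 * η) * w c₀ * R 0 := by
  -- along the line `t ↦ t • ez` the function is `(η + t)(T₀ - η - t) w(c₀) R(0)`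
  have hline : ∀ t : ℝ, colFn3 w ρ R c₀ ε κ η T₀ (t • ez) = (η + t) * (T₀ - (η + t)) * w c₀ * R 0 := by
    intro t
    have hp : PlanarThickening.proj (t • ez) = 0 := by rw [map_smul, PlanarThickening.proj_ez, smul_zero]
    simp only [colFn3, hp, nsq_zero, gmod_zero, PiLp.smul_apply, PlanarThickening.ez_apply_two, smul_eq_mul,
      mul_one, sub_zero, mul_zero, zero_mul, add_zero]
  have hd : DifferentiableAt ℝ (colFn3 w ρ R c₀ ε κ η T₀) 0 :=
    (contDiff_colFn3 (c₀ := c₀) (ε := ε) (κ := κ) (η := η) (T₀ := T₀) hw hρ hR).differentiable (by norm_num) 0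
  have hγ : HasDerivAt (fun t : ℝ => t • ez) ez 0 := by
    simpa using (hasDerivAt_id (0 : ℝ)).smul_const ez
  have h1 : HasDerivAt (fun t : ℝ => colFn3 w ρ R c₀ ε κ η T₀ (t • ez))
      (fderiv ℝ (colFn3 w ρ R c₀ ε κ η T₀) 0 ez) 0 :=
    hd.hasFDerivAt.comp_hasDerivAt_of_eq 0 hγ (by rw [zero_smul])
  have h2 : HasDerivAt (fun t : ℝ => (η + t) * (T₀ - (η + t)) * w c₀ * R 0) ((T₀ - 2 * η) * w c₀ * R 0) 0 := by
    have ha : HasDerivAt (fun t : ℝ => η + t) 1 0 := (hasDerivAt_id (0 : ℝ)).const_add η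
    have hb : HasDerivAt (fun t : ℝ => T₀ - (η + t)) (-1) 0 := ha.const_sub T₀
    have h := ((ha.mul hb).mul_const (w c₀)).mul_const (R 0)
    refine h.congr_deriv ?_
    simp only [add_zero]
    ring
  have hfun : (fun t : ℝ => colFn3 w ρ R c₀ ε κ η T₀ (t • ez)) = fun t => (η + t) * (T₀ - (η + t)) * w c₀ * R 0 :=
    funext hline
  rw [hfun] at h1
  exact h1.unique h2

/-- **`1 - C G` has a nondegenerate critical point of index `0` at the centre** (`C > 0`,
`T₀ < 2η`, `w(c₀) > 0`, `R(0) > 0`, `𝒜(0) = η(T₀ - η)R(0) > 0`, `ρ(0) ≥ 0`, `w'(c₀) ≤ 0`, `c₀ ε ≥ 0`,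
and the design inequality at the centre): by `TrisectionsRadialThickening` the Hessian there is
the core Hessian (positive definite for `1 - C G`, `ChartZone.fderiv_fderiv_core_zero_apply_self_neg`)
plus a positive multiple of `|v_y|²`. [cite: GayKirby2016, §4, Lemma 14] [cite: Milnor1963, §2] -/
theorem morseData_one_sub_colFn_zero (hw : ContDiff ℝ 2 w) (hρ : ContDiff ℝ 2 ρ) (hR : ContDiff ℝ 2 R)
    {C : ℝ} (hC : 0 < C) (hT : T₀ < 2 * η) (hw0 : 0 < w c₀) (hR0 : 0 < R 0)
    (hApos : 0 < η * (T₀ - η) * R 0) (hρ0 : 0 ≤ ρ 0) (hw' : deriv w c₀ ≤ 0) (hcε : 0 ≤ c₀ * ε)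
    (hD : DesignIneq (fun a => (η - a) * (T₀ - η + a) * R a) w ρ c₀ ε 0 c₀) :
    IsMCriticalPt (𝓡 4) (fun u => 1 - C * colFn w ρ R c₀ ε κ η T₀ u) 0 ∧
      (mhessian (𝓡 4) (fun u => 1 - C * colFn w ρ R c₀ ε κ η T₀ u) 0).Nondegenerate ∧
      morseIndex (𝓡 4) (fun u => 1 - C * colFn w ρ R c₀ ε κ η T₀ u) 0 = 0 := by
  set Φ := colFn3 w ρ R c₀ ε κ η T₀ with hΦdef
  set A : ℝ → ℝ := fun a => (η - a) * (T₀ - η + a) * R a with hAdef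
  have hrt : (fun u => 1 - C * colFn w ρ R c₀ ε κ η T₀ u) = rthicken fun q => 1 - C * Φ q := by
    funext u; rfl
  rw [hrt]
  have hΦc : ContDiff ℝ 2 Φ := contDiff_colFn3 hw hρ hR
  have hΦ'c : ContDiff ℝ 2 fun q => 1 - C * Φ q := contDiff_const.sub (contDiff_const.mul hΦc)
  have hΦ'2 : ContDiffAt ℝ 2 (fun q => 1 - C * Φ q) (toModel 0) := hΦ'c.contDiffAt
  have hΦ'd : DifferentiableAt ℝ (fun q => 1 - C * Φ q) (toModel 0) := hΦ'2.differentiableAt (by norm_num)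
  -- `∂/∂b` of `1 - CΦ` at `0` is positive
  have hfd : fderiv ℝ (fun q => 1 - C * Φ q) = fun q => -C • fderiv ℝ Φ q := by
    funext q
    have hd : DifferentiableAt ℝ Φ q := hΦc.differentiable (by norm_num) q
    rw [fderiv_const_sub, fderiv_const_mul hd, neg_smul]
  have hb : fderiv ℝ Φ 0 ez < 0 := by
    rw [hΦdef, fderiv_colFn3_zero_ez hw hρ hR]
    have : (T₀ - 2 * η) * (w c₀ * R 0) < 0 := mul_neg_of_neg_of_pos (by linarith) (mul_pos hw0 hR0)
    linarith [show (T₀ - 2 * η) * w c₀ * R 0 = (T₀ - 2 * η) * (w c₀ * R 0) by ring]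
  have hb' : 0 < fderiv ℝ (fun q => 1 - C * Φ q) (toModel 0) ez := by
    rw [hfd, ChartZone.toModel_zero]
    simp only [FunLike.coe_smul, Pi.smul_apply, smul_eq_mul]
    nlinarith
  -- the core of `1 - CΦ`
  have hA2 : ContDiff ℝ 2 A :=
    ((contDiff_const.sub contDiff_id).mul (contDiff_const.add contDiff_id)).mul hR
  have hcoreΦ : Φ ∘ (lift : 𝔼 2 →L[ℝ] 𝔼 3) = core A w ρ c₀ ε := colFn3_comp_lift
  have hcore' : (fun q => 1 - C * Φ q) ∘ (lift : 𝔼 2 →L[ℝ] 𝔼 3) = fun x => 1 - C * core A w ρ c₀ ε x := by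
    funext x
    have := congrFun hcoreΦ x
    simp only [comp_apply] at this ⊢
    rw [this]
  have hAd := hA2.differentiable (by norm_num)
  have hwd := hw.differentiable (by norm_num)
  have hρd := hρ.differentiable (by norm_num)
  have hcored : Differentiable ℝ (core A w ρ c₀ ε) := fun x => differentiableAt_core (hAd _) (hwd _) (hρd _)
  have hfd2 : fderiv ℝ (fun x => 1 - C * core A w ρ c₀ ε x) = fun x => -C • fderiv ℝ (core A w ρ c₀ ε) x := by
    funext x
    rw [fderiv_const_sub, fderiv_const_mul (hcored x), neg_smul]
  -- criticality at the centre
  have hcrit2 : IsMCriticalPt (𝓡 2) ((fun q => 1 - C * Φ q) ∘ (lift : 𝔼 2 →L[ℝ] 𝔼 3)) (RadialThickening.proj 0) := by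
    rw [hcore', map_zero, MorseBirth.isMCriticalPt_iff_fderiv, hfd2]
    simp only [fderiv_core_zero hAd hwd hρd, smul_zero]
  have hcrit : IsMCriticalPt (𝓡 4) (rthicken fun q => 1 - C * Φ q) 0 :=
    (isMCriticalPt_rthicken_iff hΦ'd hb'.ne').2 ⟨rfl, rfl, hcrit2⟩
  -- the planar Hessian of `1 - C core` at `0` is positive definite
  have hH2 : ∀ v u : 𝔼 2, fderiv ℝ (fderiv ℝ (fun x => 1 - C * core A w ρ c₀ ε x)) 0 v u =
      -C * fderiv ℝ (fderiv ℝ (core A w ρ c₀ ε)) 0 v u := by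
    intro v u
    have hD := hasFDerivAt_fderiv_core_zero (c := c₀) (ε := ε) hA2 hw hρ
    have hD' : HasFDerivAt (fun x => -C • fderiv ℝ (core A w ρ c₀ ε) x) (-C • _) 0 := hD.const_smul (-C)
    rw [hfd2, hD'.fderiv, hD.fderiv]
    simp only [smul_apply, smul_eq_mul]
  have hApos0 : 0 < A 0 := by simp only [hAdef, sub_zero, add_zero]; exact hApos
  have hpd : ∀ v : 𝔼 2, v ≠ 0 → 0 < fderiv ℝ (fderiv ℝ (fun x => 1 - C * core A w ρ c₀ ε x)) 0 v v := by
    intro v hv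
    rw [hH2]
    have := fderiv_fderiv_core_zero_apply_self_neg hA2 hw hρ hApos0 hρ0 hw' hcε hD hv
    nlinarith
  have hposdef : (mhessian (𝓡 2) ((fun q => 1 - C * Φ q) ∘ (lift : 𝔼 2 →L[ℝ] 𝔼 3))
      (RadialThickening.proj 0)).toQuadraticMap.PosDef := by
    intro v hv
    rw [hcore', map_zero]
    simp only [LinearMap.BilinMap.toQuadraticMap_apply, MorseBirth.mhessian_model_apply]
    exact hpd v hv
  have hnd2 : (mhessian (𝓡 2) ((fun q => 1 - C * Φ q) ∘ (lift : 𝔼 2 →L[ℝ] 𝔼 3))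
      (RadialThickening.proj 0)).Nondegenerate := by
    refine ⟨fun v hv => ?_, fun v hv => ?_⟩
    · by_contra h0
      have := hposdef v h0
      simp only [LinearMap.BilinMap.toQuadraticMap_apply, hv v] at this
      exact lt_irrefl _ this
    · by_contra h0
      have := hposdef v h0
      simp only [LinearMap.BilinMap.toQuadraticMap_apply, hv v] at this
      exact lt_irrefl _ this
  refine ⟨hcrit, ?_, ?_⟩
  · exact (nondegenerate_mhessian_rthicken_iff hΦ'2 rfl rfl hb'.ne').2 hnd2
  · rw [morseIndex_rthicken hΦ'2 rfl rfl hb']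
    unfold morseIndex
    exact LinearMap.BilinForm.sigNeg_eq_zero_of_posDef hposdef

end TubeColumn

end Literature.Topology.FourManifolds

end
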